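import Summits.QuantumFields.YangMills.Theorems.SwapVirialDeficitPeriodicTwoScaleLimitGap
import Summits.QuantumFields.YangMills.Theorems.SwapVirialDeficitPeriodicPrincipalLogLimitLevel
import Summits.QuantumFields.YangMills.Theorems.SwapVirialDeficitBlowUpPeriodicTwoScaleChartLevel
import HarnessLib

/-!
# The PERIODIC massive-mode rung, brick PM-IV′ at LEVEL `r` (good-threshold route): the fixed-`L` relative gap from (I3′r) ALONE
# (free-hands support of ⟨stmt-QuantumFields-24196⟩ `SwapVirialDeficit.ToronSoftnessSharp`; composes LEAD ym-line-sfw-p2 g96's ✓`periodicPrincipalLogLimit_of_twoScale_level` (PJ6 at level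
# `r·t²`), ✓`periodicKernel_eq_twoScaleVolumeR` (I1′r), ✓`twoScaleVolumeR_le` (I2′r) with my ✓`BlowUp.twoScale_upper_disc`/✓`twoScale_lower` (generic in the kernel) and
# ✓`relativeGap_fixedL_of_periodicLogLimit`)

★★★ `relativeGap_fixedL_of_twoScaleLimit_level`: for every `ε > 0` there is `L₀` such that for `L ≥ L₀` and EVERY level `r > 0`, any measurable bounded profile `M`
with `twoScaleVolumeR L r u s a₀ → M a₀` locally uniformly off `a₀ = 0` (both halves of (I3′r)) and `0 < ∫_{(−1,1)} 4π·M` gives, eventually in `β`,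
`β·(log Z^S_L)′(β) − β·(log Z^{phys}_L)′(β) ≤ −(1/2 − 2ε)`.  (The principal log-limit value is `coneConst^{6L⁴+1}·gI/(4·r^{9L⁴−3/2}) > 0`.)
HONEST LABEL: glue; the two-scale limit (I3′r) at a good level (LEAD g96's PM-IIb/IId-level) is NOT proved here; ⟨24196⟩/⟨24497⟩ OPEN; own crux ⟨22884⟩ OPEN (blocked-on ⟨19935⟩);
the Yang–Mills mass gap is NOT proved; no summit is proved by a line.  Width seat ym-line-sfw-p2-w3 g64 (cell ym-idea-1, free hands), `--supports stmt-QuantumFields-24196`.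
THEOREMS ONLY (0 `def`, 0 `sorry`), standard axioms.  References: [cite: Luscher1983, §2]; [cite: GonzalezarroyoAltes1988]; [folklore].
-/

set_option autoImplicit false

noncomputable section

open MeasureTheory Set Filter Topology
open scoped ENNReal
open Literature.MathematicalPhysics.QuantumLattice
open Literature.MathematicalPhysics.QuantumFieldTheory hiding SU2
open Summit.QuantumFields.YangMills.Theorems.SwapTwistDeficit.ToronLog

namespace Summit.QuantumFields.YangMills.Theorems.SwapVirialDeficit.BlowUpRing

open Summit.QuantumFields.YangMills.Theorems.FemtoTransferGap
open Summit.QuantumFields.YangMills.Theorems.FemtoTransferGap.TT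
open Summit.QuantumFields.YangMills.Theorems.SwapVirialDeficit.BlowUp (twoScale_upper_disc twoScale_lower)

/-- ★★★ **THE FIXED-`L` RELATIVE GAP FROM (I3′r) AT ANY LEVEL `r > 0`** ((I1′r), (I2′r), PJ6-level discharged by name). [cite: Luscher1983, §2] [cite: GonzalezarroyoAltes1988] -/
theorem relativeGap_fixedL_of_twoScaleLimit_level {ε : ℝ} (hε : 0 < ε) :
    ∃ L₀ : ℕ, ∀ (L : ℕ) [NeZero L], L₀ ≤ L → ∀ {r : ℝ}, 0 < r →
      ∀ (M : ℝ → ℝ≥0∞) (Mmax : ℝ≥0∞), Mmax ≠ ∞ → Measurable M → (∀ a₀, M a₀ ≤ Mmax) →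
      (∀ ε' : ℝ, 0 < ε' → ∀ r₀ ∈ Ioo (0 : ℝ) 1, ∃ θ : ℝ, 0 < θ ∧ ∀ a₀ : ℝ, r₀ ≤ |a₀| → |a₀| ≤ 1 →
        ∀ u ∈ Ioo (0 : ℝ) θ, ∀ s ∈ Ioo (0 : ℝ) θ, twoScaleVolumeR L r u s a₀ ≤ M a₀ + ENNReal.ofReal ε') →
      (∀ ε' : ℝ, 0 < ε' → ∀ r₀ ∈ Ioo (0 : ℝ) 1, ∃ θ : ℝ, 0 < θ ∧ ∀ a₀ : ℝ, r₀ ≤ |a₀| → |a₀| ≤ 1 →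
        ∀ u ∈ Ioo (0 : ℝ) θ, ∀ s ∈ Ioo (0 : ℝ) θ, M a₀ ≤ twoScaleVolumeR L r u s a₀ + ENNReal.ofReal ε') →
      0 < (∫⁻ a₀ in Ioo (-1 : ℝ) 1, ENNReal.ofReal (4 * Real.pi) * M a₀ ∂volume).toReal →
      ∃ β₀ : ℝ, ∀ β : ℝ, β₀ ≤ β →
        β * deriv (fun b : ℝ => Real.log (TT.twistTrace L b (2 * L))) β -
            β * deriv (fun b : ℝ => Real.log (TT.physTrace L b (2 * L))) β ≤ -(1 / 2 - 2 * ε) := by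
  obtain ⟨L₀, h⟩ := relativeGap_fixedL_of_periodicLogLimit hε
  refine ⟨L₀, fun L _ hL r hr M Mmax hMmax hM hMV hup hlo hgI => ?_⟩
  obtain ⟨Vmax, hVmax, hV⟩ := twoScaleVolumeR_le (L := L) hr.le
  have hVmax' : max Vmax Mmax ≠ ∞ := by simp [hVmax, hMmax]
  have hc : 0 < coneConst := coneConst_pos
  have hv : 0 < coneConst ^ (6 * L ^ 4 + 1) * (∫⁻ a₀ in Ioo (-1 : ℝ) 1, ENNReal.ofReal (4 * Real.pi) * M a₀ ∂volume).toReal /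
      (4 * r ^ (9 * (L : ℝ) ^ 4 - 3 / 2)) := by positivity
  refine h L hL hv (periodicPrincipalLogLimit_of_twoScale_level L hr hgI.le (fun ε' hε' => ?_) (fun ε' hε' => ?_))
  · exact twoScale_upper_disc (fun t p => periodicKernel L (fun _ => false) (fun _ => 1) t (r * t ^ 2) p) (twoScaleVolumeR L r) M hVmax'
      (fun t a₀ ρ _ hρ hin => periodicKernel_eq_twoScaleVolumeR r t hρ hin) (fun t a₀ ρ _ _ hle => periodicKernel_eq_zero_of_le L _ _ _ _ a₀ ρ hle)
      (fun u s a₀ hu hs hd => (hV u s a₀ hu hs hd).trans (le_max_left _ _)) hM (fun a₀ => (hMV a₀).trans (le_max_right _ _)) hup hε'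
  · exact twoScale_lower (fun t p => periodicKernel L (fun _ => false) (fun _ => 1) t (r * t ^ 2) p) (twoScaleVolumeR L r) M hVmax'
      (fun t a₀ ρ _ hρ hin => periodicKernel_eq_twoScaleVolumeR r t hρ hin) hM (fun a₀ => (hMV a₀).trans (le_max_right _ _)) hlo hε'

end Summit.QuantumFields.YangMills.Theorems.SwapVirialDeficit.BlowUpRing

end
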